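import Literature.NumberTheory.LFunctions.RudnickSarnakSieving
import Mathlib.GroupTheory.Perm.Cycle.Factors
import Mathlib.GroupTheory.Perm.Fin
import Mathlib.Logic.Equiv.Fin.Rotate
import HarnessLib

/-!
# Permutations with prescribed orbit partition; the Möbius function of `Π_n` (RS (4.4))

Combinatorial infrastructure for Rudnick–Sarnak §4 (Duke Math. J. 81 (1996)): in the proof
of Proposition 4.2 (p. 311) "we decompose the permutations into products of disjoint cyclic
permutations indexed by set partitions `F` of `N = {1, …, n}`: `S_n = ⨆_F ∏_j S*(F_j)`, where
`S*(F)` denotes the set of all cyclic permutations of the indices in `F`. The sign of any cyclic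
permutation in `S*(F)` is `(-1)^{|F|-1}`"; and (p. 312) the cyclic permutations of an `n`-set,
"orderings modulo rotations", number `(n - 1)!`.

* `fib 𝓒` — the permutations that are cyclic on every block `C ∈ 𝓒` and the identity off
  `⋃ 𝓒`; `fib {C}` is `S*(C)`.
* `sum_fib_insert`, `sum_fib_eq_prod` — sums of block-multiplicative weights over `fib 𝓒`
  factor over the blocks (`S ↦ (S|_C)_C` is a bijection `fib 𝓒 ≃ ∏_C S*(C)`).
* `sum_cyc_sum_eq_sum_perm` — `S*(C) × C ≃ {orderings of C}`, `(τ, b) ↦ (τ b, τ² b, …, τ^ℓ b = b)`;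
  hence `card_cyc : #S*(C) = (|C| - 1)!` and `sign_of_mem_cyc : sign = (-1)^{|C|-1}`.
* `cyclePart σ` — the orbit partition; `sum_perm_eq_sum_cyclePart` groups `∑_{σ ∈ S_n}` by it.
* `sum_le_prod_moebius` — `∑_{P ≤ Q} ∏_{t ∈ P} (-1)^{|t|-1} (|t|-1)! = [Q = O]` (the sum is
  `∑_{σ ∈ Stab(Q)} sign σ`, killed by a transposition inside a non-trivial block), and from it
  **`partitionMoebius_eq_prod_holds`**, discharging the named fact
  `Literature.NumberTheory.LFunctions.RudnickSarnak.partitionMoebius_eq_prod` (RS (4.4):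
  `μ(O, F) = ∏_j (-1)^{|F_j|-1} (|F_j|-1)!`, Rota 1964).

## References

* Z. Rudnick, P. Sarnak, Duke Math. J. 81 (1996), 269–322: (4.2)–(4.4), proof of Prop. 4.2
  (p. 311), (4.33) (p. 312).
* G.-C. Rota, *On the foundations of combinatorial theory I*, Z. Wahrsch. 2 (1964), §7.
-/

noncomputable section

open Finset Equiv Equiv.Perm

namespace Literature.NumberTheory.LFunctions

namespace RudnickSarnak

variable {α : Type*} [Fintype α] [DecidableEq α]

/-! ## Permutations cyclic on prescribed blocks -/

open scoped Classical in
/-- `fib 𝓒`: the permutations of `α` which are cyclic (`Equiv.Perm.IsCycleOn`) on every block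
`C ∈ 𝓒` and fix every point outside `⋃ 𝓒`. For a set partition `G`, `fib G.parts` is the set of
permutations whose orbit partition is `G` (`mem_fib_parts_iff`); `fib {C}` is Rudnick–Sarnak's
`S*(C)`, the cyclic permutations of `C`. [cite: RudnickSarnak1996, proof of Prop 4.2] -/
def fib (𝓒 : Finset (Finset α)) : Finset (Perm α) :=
  univ.filter fun σ ↦ (∀ C ∈ 𝓒, σ.IsCycleOn (C : Set α)) ∧ ∀ x, (∀ C ∈ 𝓒, x ∉ C) → σ x = x

/-- Membership in `fib 𝓒`. [folklore] -/
theorem mem_fib {𝓒 : Finset (Finset α)} {σ : Perm α} :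
    σ ∈ fib 𝓒 ↔ (∀ C ∈ 𝓒, σ.IsCycleOn (C : Set α)) ∧ ∀ x, (∀ C ∈ 𝓒, x ∉ C) → σ x = x := by
  unfold fib
  simp only [Finset.mem_filter, Finset.mem_univ, true_and]

/-- Membership in `S*(C) = fib {C}`. [folklore] -/
theorem mem_cyc {C : Finset α} {σ : Perm α} :
    σ ∈ fib {C} ↔ σ.IsCycleOn (C : Set α) ∧ ∀ x, x ∉ C → σ x = x := by
  rw [mem_fib]
  simp

/-- `fib ∅ = {1}`. [folklore] -/
theorem fib_empty : fib (∅ : Finset (Finset α)) = {1} := by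
  ext σ
  rw [mem_fib, Finset.mem_singleton]
  constructor
  · intro h
    ext x
    simpa using h.2 x (by simp)
  · rintro rfl
    simp

omit [Fintype α] [DecidableEq α] in
/-- Powers of permutations that agree on an invariant block agree on the block. [folklore] -/
theorem pow_apply_eq_of_eqOn {σ τ : Perm α} {C : Finset α} (hmaps : ∀ x ∈ C, τ x ∈ C)
    (h : ∀ x ∈ C, σ x = τ x) (m : ℕ) {x : α} (hx : x ∈ C) :
    (σ ^ m) x = (τ ^ m) x ∧ (τ ^ m) x ∈ C := by
  induction m with
  | zero => simpa using hx
  | succ m ih =>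
    obtain ⟨h1, h2⟩ := ih
    rw [pow_succ', pow_succ', Perm.mul_apply, Perm.mul_apply, h1, h _ h2]
    exact ⟨rfl, hmaps _ h2⟩

omit [Fintype α] [DecidableEq α] in
/-- `IsCycleOn C` only depends on the values on `C`. [folklore] -/
theorem isCycleOn_of_eqOn {σ τ : Perm α} {C : Finset α} (hτ : τ.IsCycleOn (C : Set α))
    (h : ∀ x ∈ C, σ x = τ x) : σ.IsCycleOn (C : Set α) := by
  have hmaps : ∀ x ∈ C, τ x ∈ C := fun x hx ↦ by
    have := hτ.1.mapsTo (Finset.mem_coe.2 hx)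
    simpa using this
  refine ⟨⟨fun x hx ↦ ?_, fun x _ y _ hxy ↦ σ.injective hxy, fun y hy ↦ ?_⟩, ?_⟩
  · have hx' : x ∈ C := by simpa using hx
    rw [h x hx']
    simpa using hmaps x hx'
  · obtain ⟨x, hx, hxy⟩ := hτ.1.surjOn hy
    refine ⟨x, hx, ?_⟩
    have hx' : x ∈ C := by simpa using hx
    rw [h x hx', hxy]
  · intro x hx y hy
    have hx' : x ∈ C := by simpa using hx
    have hy' : y ∈ C := by simpa using hy
    obtain ⟨m, -, hm⟩ := hτ.exists_pow_eq hx' hy'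
    exact ⟨m, by rw [zpow_natCast, (pow_apply_eq_of_eqOn hmaps h m hx').1, hm]⟩

omit [Fintype α] [DecidableEq α] in
/-- A permutation cyclic on `C` maps `C` to itself. [folklore] -/
theorem IsCycleOn.apply_mem' {τ : Perm α} {C : Finset α} (hτ : τ.IsCycleOn (C : Set α))
    {x : α} (hx : x ∈ C) : τ x ∈ C := by
  have := hτ.1.mapsTo (Finset.mem_coe.2 hx)
  simpa using this

/-! ### Restriction of a permutation to a block and to its complement -/

/-- `ρ` on `C` and the identity off `C` (when `ρ` preserves `C`; else `1`). [folklore] -/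
def onBlock (ρ : Perm α) (C : Finset α) : Perm α :=
  if h : ∀ x, ρ x ∈ C ↔ x ∈ C then ofSubtype (ρ.subtypePerm (p := fun x ↦ x ∈ C) h) else 1

/-- `ρ` off `C` and the identity on `C` (when `ρ` preserves `C`; else `1`). [folklore] -/
def offBlock (ρ : Perm α) (C : Finset α) : Perm α :=
  if h : ∀ x, ρ x ∈ C ↔ x ∈ C then
    ofSubtype (ρ.subtypePerm (p := fun x ↦ x ∉ C) (fun x ↦ not_congr (h x))) else 1

section restrict

variable {ρ : Perm α} {C : Finset α} (h : ∀ x, ρ x ∈ C ↔ x ∈ C)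
include h

/-- [folklore] -/
theorem onBlock_apply_of_mem {x : α} (hx : x ∈ C) : onBlock ρ C x = ρ x := by
  rw [onBlock, dif_pos h]
  exact ofSubtype_apply_of_mem _ hx

/-- [folklore] -/
theorem onBlock_apply_of_not_mem {x : α} (hx : x ∉ C) : onBlock ρ C x = x := by
  rw [onBlock, dif_pos h]
  exact ofSubtype_apply_of_not_mem _ hx

/-- [folklore] -/
theorem offBlock_apply_of_mem {x : α} (hx : x ∈ C) : offBlock ρ C x = x := by
  rw [offBlock, dif_pos h]
  exact ofSubtype_apply_of_not_mem (p := fun x ↦ x ∉ C) _ (not_not.2 hx)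

/-- [folklore] -/
theorem offBlock_apply_of_not_mem {x : α} (hx : x ∉ C) : offBlock ρ C x = ρ x := by
  rw [offBlock, dif_pos h]
  exact ofSubtype_apply_of_mem (p := fun x ↦ x ∉ C) _ hx

/-- `ρ = (ρ off C) * (ρ on C)`. [folklore] -/
theorem offBlock_mul_onBlock : offBlock ρ C * onBlock ρ C = ρ := by
  ext x
  rw [Perm.mul_apply]
  by_cases hx : x ∈ C
  · rw [onBlock_apply_of_mem h hx, offBlock_apply_of_mem h ((h x).2 hx)]
  · rw [onBlock_apply_of_not_mem h hx, offBlock_apply_of_not_mem h hx]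

end restrict

/-! ### Factorisation over blocks -/

/-- **Binary factorisation.** If `C` is disjoint from the blocks of `𝓒`, then
`(σ', τ) ↦ σ' τ` is a bijection `fib 𝓒 × S*(C) → fib (insert C 𝓒)`; so a weight `F` with
`F(σ'τ) = G(σ') H(τ)` sums to `(∑ G)(∑ H)`. [cite: RudnickSarnak1996, proof of Prop 4.2] -/
theorem sum_fib_insert {R : Type*} [CommRing R] (𝓒 : Finset (Finset α)) (C : Finset α)
    (hdisj : ∀ C' ∈ 𝓒, Disjoint C C') (F G H : Perm α → R)
    (hF : ∀ σ' ∈ fib 𝓒, ∀ τ ∈ fib {C}, F (σ' * τ) = G σ' * H τ) :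
    ∑ σ ∈ fib (insert C 𝓒), F σ = (∑ σ' ∈ fib 𝓒, G σ') * ∑ τ ∈ fib {C}, H τ := by
  -- points of `C` lie in no block of `𝓒`
  have hCout : ∀ x ∈ C, ∀ C' ∈ 𝓒, x ∉ C' := fun x hx C' hC' hx' ↦
    Finset.disjoint_left.1 (hdisj C' hC') hx hx'
  rw [Finset.sum_mul_sum, ← Finset.sum_product']
  symm
  refine Finset.sum_nbij' (fun p ↦ p.1 * p.2) (fun ρ ↦ (offBlock ρ C, onBlock ρ C))
    ?_ ?_ ?_ ?_ ?_
  · -- maps into `fib (insert C 𝓒)`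
    rintro ⟨σ', τ⟩ hp
    obtain ⟨hσ', hτ⟩ := Finset.mem_product.1 hp
    rw [mem_fib] at hσ' ⊢
    rw [mem_cyc] at hτ
    have hfixC : ∀ x ∈ C, σ' x = x := fun x hx ↦ hσ'.2 x (hCout x hx)
    have honC : ∀ x ∈ C, (σ' * τ) x = τ x := fun x hx ↦ by
      rw [Perm.mul_apply, hfixC _ (IsCycleOn.apply_mem' hτ.1 hx)]
    have hoffC : ∀ x, x ∉ C → (σ' * τ) x = σ' x := fun x hx ↦ by
      rw [Perm.mul_apply, hτ.2 x hx]
    refine ⟨fun C' hC' ↦ ?_, fun x hx ↦ ?_⟩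
    · rcases Finset.mem_insert.1 hC' with rfl | hC'
      · exact isCycleOn_of_eqOn hτ.1 honC
      · refine isCycleOn_of_eqOn (hσ'.1 C' hC') fun x hx ↦ hoffC x ?_
        exact fun hxC ↦ hCout x hxC C' hC' hx
    · have hxC : x ∉ C := hx C (Finset.mem_insert_self C 𝓒)
      rw [hoffC x hxC]
      exact hσ'.2 x fun C' hC' ↦ hx C' (Finset.mem_insert_of_mem hC')
  · -- maps into the product
    intro ρ hρ
    rw [mem_fib] at hρ
    have hρC : ρ.IsCycleOn (C : Set α) := hρ.1 C (Finset.mem_insert_self C 𝓒)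
    have h : ∀ x, ρ x ∈ C ↔ x ∈ C := fun x ↦ by
      have := hρC.apply_mem_iff (x := x)
      simpa using this
    refine Finset.mem_product.2 ⟨?_, ?_⟩
    · rw [mem_fib]
      refine ⟨fun C' hC' ↦ ?_, fun x hx ↦ ?_⟩
      · refine isCycleOn_of_eqOn (hρ.1 C' (Finset.mem_insert_of_mem hC')) fun x hx ↦ ?_
        exact offBlock_apply_of_not_mem h fun hxC ↦ hCout x hxC C' hC' hx
      · by_cases hxC : x ∈ C
        · exact offBlock_apply_of_mem h hxC
        · rw [offBlock_apply_of_not_mem h hxC]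
          refine hρ.2 x fun C' hC' ↦ ?_
          rcases Finset.mem_insert.1 hC' with rfl | hC'
          · exact hxC
          · exact hx C' hC'
    · rw [mem_cyc]
      exact ⟨isCycleOn_of_eqOn hρC fun x hx ↦ onBlock_apply_of_mem h hx,
        fun x hx ↦ onBlock_apply_of_not_mem h hx⟩
  · -- left inverse
    rintro ⟨σ', τ⟩ hp
    obtain ⟨hσ', hτ⟩ := Finset.mem_product.1 hp
    rw [mem_fib] at hσ'
    rw [mem_cyc] at hτ
    have hfixC : ∀ x ∈ C, σ' x = x := fun x hx ↦ hσ'.2 x (hCout x hx)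
    have h : ∀ x, (σ' * τ) x ∈ C ↔ x ∈ C := by
      intro x
      rw [Perm.mul_apply]
      by_cases hx : x ∈ C
      · have h1 : τ x ∈ C := IsCycleOn.apply_mem' hτ.1 hx
        rw [hfixC _ h1]
        exact ⟨fun _ ↦ hx, fun _ ↦ h1⟩
      · rw [hτ.2 x hx]
        refine ⟨fun h' ↦ ?_, fun h' ↦ absurd h' hx⟩
        have : σ' (σ' x) = σ' x := hfixC _ h'
        exact absurd (h' : σ' x ∈ C) (by rwa [σ'.injective this] at h' ⊢)
    simp only [Prod.mk.injEq]
    constructor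
    · ext x
      by_cases hx : x ∈ C
      · rw [offBlock_apply_of_mem h hx, hfixC x hx]
      · rw [offBlock_apply_of_not_mem h hx, Perm.mul_apply, hτ.2 x hx]
    · ext x
      by_cases hx : x ∈ C
      · rw [onBlock_apply_of_mem h hx, Perm.mul_apply, hfixC _ (IsCycleOn.apply_mem' hτ.1 hx)]
      · rw [onBlock_apply_of_not_mem h hx, hτ.2 x hx]
  · -- right inverse
    intro ρ hρ
    rw [mem_fib] at hρ
    have hρC : ρ.IsCycleOn (C : Set α) := hρ.1 C (Finset.mem_insert_self C 𝓒)
    have h : ∀ x, ρ x ∈ C ↔ x ∈ C := fun x ↦ by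
      have := hρC.apply_mem_iff (x := x)
      simpa using this
    exact offBlock_mul_onBlock h
  · -- the weight
    rintro ⟨σ', τ⟩ hp
    obtain ⟨hσ', hτ⟩ := Finset.mem_product.1 hp
    exact (hF σ' hσ' τ hτ).symm

/-- **Factorisation over the blocks** (RS p. 311: `S_n ⊇ fib(F) = ∏_j S*(F_j)`): for pairwise
disjoint blocks `𝓒` and block-local weights `w_C(σ)` (depending only on `σ|_C`),
`∑_{σ ∈ fib 𝓒} sign σ ∏_C w_C(σ) = ∏_C ∑_{τ ∈ S*(C)} sign τ · w_C(τ)`.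
[cite: RudnickSarnak1996, proof of Prop 4.2] -/
theorem sum_fib_eq_prod {R : Type*} [CommRing R] (𝓒 : Finset (Finset α))
    (hd : (𝓒 : Set (Finset α)).PairwiseDisjoint id) (w : Finset α → Perm α → R)
    (hw : ∀ C ∈ 𝓒, ∀ σ σ' : Perm α, (∀ x ∈ C, σ x = σ' x) → w C σ = w C σ') :
    ∑ σ ∈ fib 𝓒, ((Equiv.Perm.sign σ : ℤ) : R) * ∏ C ∈ 𝓒, w C σ =
      ∏ C ∈ 𝓒, ∑ τ ∈ fib {C}, ((Equiv.Perm.sign τ : ℤ) : R) * w C τ := by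
  induction 𝓒 using Finset.induction_on with
  | empty => simp [fib_empty]
  | insert C 𝓒 hC ih =>
    have hd' : (𝓒 : Set (Finset α)).PairwiseDisjoint id :=
      hd.subset (Finset.coe_subset.2 (Finset.subset_insert _ _))
    have hdisj : ∀ C' ∈ 𝓒, Disjoint C C' := fun C' hC' ↦
      hd (Finset.mem_insert_self C 𝓒) (Finset.mem_insert_of_mem hC') (fun h ↦ hC (h ▸ hC'))
    have hCout : ∀ x ∈ C, ∀ C' ∈ 𝓒, x ∉ C' := fun x hx C' hC' hx' ↦
      Finset.disjoint_left.1 (hdisj C' hC') hx hx'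
    rw [Finset.prod_insert hC, ← ih hd' (fun C' hC' ↦ hw C' (Finset.mem_insert_of_mem hC')),
      mul_comm]
    refine sum_fib_insert 𝓒 C hdisj _ _ _ fun σ' hσ' τ hτ ↦ ?_
    rw [mem_fib] at hσ'
    rw [mem_cyc] at hτ
    have hfixC : ∀ x ∈ C, σ' x = x := fun x hx ↦ hσ'.2 x (hCout x hx)
    have honC : ∀ x ∈ C, (σ' * τ) x = τ x := fun x hx ↦ by
      rw [Perm.mul_apply, hfixC _ (IsCycleOn.apply_mem' hτ.1 hx)]
    have hoffC : ∀ C' ∈ 𝓒, ∀ x ∈ C', (σ' * τ) x = σ' x := fun C' hC' x hx ↦ by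
      rw [Perm.mul_apply, hτ.2 x (fun hxC ↦ hCout x hxC C' hC' hx)]
    rw [Finset.prod_insert hC, hw C (Finset.mem_insert_self C 𝓒) _ _ honC,
      Finset.prod_congr rfl (fun C' hC' ↦ hw C' (Finset.mem_insert_of_mem hC') _ _ (hoffC C' hC')),
      map_mul, Units.val_mul, Int.cast_mul]
    ring

/-! ## Cyclic permutations of one block and its orderings -/

/-- The orbit of `b` under `τ` read as a sequence of length `ℓ`: `(τ b, τ² b, …, τ^ℓ b)`; for
`τ` cyclic on a block `C ∋ b` of size `ℓ` this is an ordering of `C` ending at `b`.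
[cite: RudnickSarnak1996, (4.29)] -/
def orbitSeq (τ : Perm α) (b : α) (ℓ : ℕ) : Fin ℓ → α := fun t ↦ (τ ^ (t.val + 1)) b

open scoped Classical in
/-- The orderings of a block `C`: injective sequences `Fin ℓ → α` with values in `C`.
[cite: RudnickSarnak1996, (4.29)] -/
def linOrders (C : Finset α) (ℓ : ℕ) : Finset (Fin ℓ → α) :=
  univ.filter fun e ↦ Function.Injective e ∧ ∀ t, e t ∈ C

/-- Membership in `linOrders`. [folklore] -/
theorem mem_linOrders {C : Finset α} {ℓ : ℕ} {e : Fin ℓ → α} :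
    e ∈ linOrders C ℓ ↔ Function.Injective e ∧ ∀ t, e t ∈ C := by
  unfold linOrders
  simp only [Finset.mem_filter, Finset.mem_univ, true_and]

section block

variable {n : ℕ} {C : Finset α} (hC : #C = n + 1)
include hC

/-- An ordering `e` of `C` as an equivalence `Fin (n+1) ≃ C`. [folklore] -/
def equivOfLinOrder (e : Fin (n + 1) → α) (he : Function.Injective e ∧ ∀ t, e t ∈ C) :
    Fin (n + 1) ≃ (C : Set α) :=
  Equiv.ofBijective (fun t ↦ ⟨e t, Finset.mem_coe.2 (he.2 t)⟩) <| by
    rw [Fintype.bijective_iff_injective_and_card]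
    refine ⟨fun s t h ↦ he.1 (congrArg Subtype.val h), ?_⟩
    simp [hC]

omit [Fintype α] [DecidableEq α] hC in
/-- [folklore] -/
theorem equivOfLinOrder_apply (hC : #C = n + 1) (e : Fin (n + 1) → α)
    (he : Function.Injective e ∧ ∀ t, e t ∈ C) (t : Fin (n + 1)) :
    ((equivOfLinOrder hC e he t : (C : Set α)) : α) = e t := rfl

/-- The cyclic permutation attached to an ordering `e` of `C`: `e t ↦ e (t + 1)`, identity off
`C` (the rotation `finRotate` transported along `e`). [cite: RudnickSarnak1996, (4.33)] -/
def rotPerm (e : Fin (n + 1) → α) : Perm α :=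
  if he : Function.Injective e ∧ ∀ t, e t ∈ C then
    (finRotate (n + 1)).extendDomain (equivOfLinOrder hC e he) else 1

omit [Fintype α] in
/-- [folklore] -/
theorem rotPerm_apply (e : Fin (n + 1) → α) (he : Function.Injective e ∧ ∀ t, e t ∈ C)
    (t : Fin (n + 1)) : rotPerm hC e (e t) = e (finRotate (n + 1) t) := by
  rw [rotPerm, dif_pos he]
  exact Perm.extendDomain_apply_image (finRotate (n + 1)) (equivOfLinOrder hC e he) t

omit [Fintype α] in
/-- [folklore] -/
theorem rotPerm_apply_of_not_mem (e : Fin (n + 1) → α)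
    (he : Function.Injective e ∧ ∀ t, e t ∈ C) {x : α} (hx : x ∉ C) : rotPerm hC e x = x := by
  rw [rotPerm, dif_pos he]
  exact Perm.extendDomain_apply_not_subtype _ _ (by simpa using hx)

omit [Fintype α] in
/-- [folklore] -/
theorem rotPerm_pow_apply (e : Fin (n + 1) → α) (he : Function.Injective e ∧ ∀ t, e t ∈ C)
    (m : ℕ) (t : Fin (n + 1)) : (rotPerm hC e ^ m) (e t) = e ((finRotate (n + 1) ^ m) t) := by
  induction m with
  | zero => simp
  | succ m ih =>
    rw [pow_succ', Perm.mul_apply, ih, rotPerm_apply hC e he, pow_succ', Perm.mul_apply]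

omit [Fintype α] [DecidableEq α] hC in
/-- Any two points of `Fin (n+1)` lie on the cycle of `finRotate`. [folklore] -/
theorem sameCycle_finRotate (s t : Fin (n + 1)) : (finRotate (n + 1)).SameCycle s t := by
  cases n with
  | zero =>
    have hs := s.isLt
    have ht := t.isLt
    have : s = t := Fin.ext (by omega)
    rw [this]
  | succ n =>
    refine isCycle_finRotate.sameCycle ?_ ?_ <;>
      exact Equiv.Perm.mem_support.1 (by rw [support_finRotate]; exact Finset.mem_univ _)

omit [Fintype α] [DecidableEq α] hC in
/-- `finRotate^{m+1}` moves the last point to `m`. [folklore] -/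
theorem finRotate_pow_succ_last {m : ℕ} (hm : m < n + 1) :
    (finRotate (n + 1) ^ (m + 1)) (Fin.last n) = ⟨m, hm⟩ := by
  induction m with
  | zero =>
    rw [zero_add, pow_one, finRotate_last]
    rfl
  | succ m ih =>
    rw [pow_succ', Perm.mul_apply, ih (by omega)]
    have hne : (⟨m, by omega⟩ : Fin (n + 1)) ≠ Fin.last n := by
      intro h
      have := congrArg Fin.val h
      simp at this
      omega
    exact Fin.ext (by rw [coe_finRotate_of_ne_last hne])

omit [Fintype α] [DecidableEq α] in
/-- Every point of `C` is some `e t`. [folklore] -/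
theorem exists_eq_of_mem (e : Fin (n + 1) → α) (he : Function.Injective e ∧ ∀ t, e t ∈ C)
    {x : α} (hx : x ∈ C) : ∃ t, e t = x := by
  obtain ⟨t, ht⟩ := (equivOfLinOrder hC e he).surjective ⟨x, Finset.mem_coe.2 hx⟩
  exact ⟨t, by simpa [equivOfLinOrder] using congrArg Subtype.val ht⟩

/-- The rotation attached to an ordering of `C` is a cyclic permutation of `C`. [folklore] -/
theorem rotPerm_mem_cyc (e : Fin (n + 1) → α) (he : Function.Injective e ∧ ∀ t, e t ∈ C) :
    rotPerm hC e ∈ fib {C} := by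
  rw [mem_cyc]
  refine ⟨⟨⟨fun x hx ↦ ?_, fun x _ y _ h ↦ (rotPerm hC e).injective h, fun y hy ↦ ?_⟩, ?_⟩,
    fun x hx ↦ rotPerm_apply_of_not_mem hC e he hx⟩
  · obtain ⟨t, rfl⟩ := exists_eq_of_mem hC e he (by simpa using hx)
    rw [rotPerm_apply hC e he]
    simpa using he.2 _
  · obtain ⟨t, rfl⟩ := exists_eq_of_mem hC e he (by simpa using hy)
    refine ⟨e ((finRotate (n + 1)).symm t), by simpa using he.2 _, ?_⟩
    rw [rotPerm_apply hC e he, Equiv.apply_symm_apply]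
  · intro x hx y hy
    obtain ⟨s, rfl⟩ := exists_eq_of_mem hC e he (by simpa using hx)
    obtain ⟨t, rfl⟩ := exists_eq_of_mem hC e he (by simpa using hy)
    obtain ⟨m, hm⟩ := (sameCycle_finRotate s t).exists_nat_pow_eq
    exact ⟨m, by rw [zpow_natCast, rotPerm_pow_apply hC e he, hm]⟩

omit hC in
/-- Powers of a permutation cyclic on `C` stay in `C`. [folklore] -/
theorem pow_apply_mem_of_mem_cyc {τ : Perm α} (hτ : τ ∈ fib {C}) (m : ℕ) {b : α} (hb : b ∈ C) :
    (τ ^ m) b ∈ C :=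
  (pow_apply_eq_of_eqOn (σ := τ) (fun _ hx ↦ IsCycleOn.apply_mem' (mem_cyc.1 hτ).1 hx)
    (fun _ _ ↦ rfl) m hb).2

/-- The orbit sequence of a cyclic permutation of `C` from a point of `C` is an ordering of `C`.
[folklore] -/
theorem orbitSeq_mem_linOrders {τ : Perm α} (hτ : τ ∈ fib {C}) {b : α} (hb : b ∈ C) :
    orbitSeq τ b (n + 1) ∈ linOrders C (n + 1) := by
  rw [mem_linOrders]
  refine ⟨fun s t hst ↦ ?_, fun t ↦ pow_apply_mem_of_mem_cyc hτ _ hb⟩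
  simp only [orbitSeq] at hst
  have hmod := ((mem_cyc.1 hτ).1.pow_apply_eq_pow_apply hb).1 hst
  rw [hC] at hmod
  have := Nat.ModEq.add_right_cancel' 1 hmod
  exact Fin.ext (by
    have h1 := Nat.mod_eq_of_lt s.isLt
    have h2 := Nat.mod_eq_of_lt t.isLt
    unfold Nat.ModEq at this
    omega)

/-- **`S*(C) × C ≃` orderings of `C`.** For a block `C` of size `n + 1`,
`(τ, b) ↦ (τ b, τ² b, …, τ^{n+1} b)` is a bijection from (cyclic permutation of `C`, point of
`C`) to the orderings of `C` (inverse: the rotation along the ordering, and its last entry);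
hence any function of orderings sums alike over both sides ("orderings modulo rotations,
i.e., over cyclic permutations", RS p. 312). [cite: RudnickSarnak1996, (4.33)] -/
theorem sum_cyc_sum_eq_sum_linOrders {R : Type*} [AddCommMonoid R] (X : (Fin (n + 1) → α) → R) :
    ∑ τ ∈ fib {C}, ∑ b ∈ C, X (orbitSeq τ b (n + 1)) = ∑ e ∈ linOrders C (n + 1), X e := by
  rw [← Finset.sum_product']
  refine Finset.sum_nbij' (fun p ↦ orbitSeq p.1 p.2 (n + 1))
    (fun e ↦ (rotPerm hC e, e (Fin.last n))) ?_ ?_ ?_ ?_ (fun _ _ ↦ rfl)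
  · rintro ⟨τ, b⟩ hp
    obtain ⟨hτ, hb⟩ := Finset.mem_product.1 hp
    exact orbitSeq_mem_linOrders hC hτ hb
  · intro e he
    rw [mem_linOrders] at he
    exact Finset.mem_product.2 ⟨rotPerm_mem_cyc hC e he, he.2 _⟩
  · rintro ⟨τ, b⟩ hp
    obtain ⟨hτ, hb⟩ := Finset.mem_product.1 hp
    have hτ' := mem_cyc.1 hτ
    have he := mem_linOrders.1 (orbitSeq_mem_linOrders hC hτ hb)
    simp only [Prod.mk.injEq]
    have hcard : (τ ^ (n + 1)) b = b := by rw [← hC]; exact hτ'.1.pow_card_apply hb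
    constructor
    · ext x
      by_cases hx : x ∈ C
      · obtain ⟨t, rfl⟩ := exists_eq_of_mem hC _ he hx
        rw [rotPerm_apply hC _ he]
        simp only [orbitSeq]
        rw [← Perm.mul_apply, ← pow_succ']
        rcases eq_or_ne t (Fin.last n) with rfl | ht
        · rw [finRotate_last, Fin.val_zero, Fin.val_last, zero_add, pow_one, pow_succ',
            Perm.mul_apply, hcard]
        · rw [coe_finRotate_of_ne_last ht]
      · rw [rotPerm_apply_of_not_mem hC _ he hx, hτ'.2 x hx]
    · simp only [orbitSeq, Fin.val_last]
      exact hcard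
  · intro e he
    rw [mem_linOrders] at he
    funext t
    simp only [orbitSeq]
    rw [rotPerm_pow_apply hC e he, finRotate_pow_succ_last t.isLt]

/-- Orderings of `C` are `e₀ ∘ σ` for a fixed ordering `e₀` and `σ ∈ S_{n+1}`. [folklore] -/
theorem sum_linOrders_eq_sum_perm {R : Type*} [AddCommMonoid R] (X : (Fin (n + 1) → α) → R)
    (e₀ : Fin (n + 1) → α) (he₀ : Function.Injective e₀ ∧ ∀ t, e₀ t ∈ C) :
    ∑ e ∈ linOrders C (n + 1), X e = ∑ σ : Perm (Fin (n + 1)), X (e₀ ∘ σ) := by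
  symm
  refine Finset.sum_nbij' (fun σ ↦ e₀ ∘ σ)
    (fun e ↦ if he : Function.Injective e ∧ ∀ t, e t ∈ C then
      (equivOfLinOrder hC e he).trans (equivOfLinOrder hC e₀ he₀).symm else 1) ?_ ?_ ?_ ?_
    (fun _ _ ↦ rfl)
  · intro σ _
    rw [mem_linOrders]
    exact ⟨he₀.1.comp σ.injective, fun t ↦ he₀.2 _⟩
  · intro e _
    exact Finset.mem_univ _
  · intro σ _
    have he : Function.Injective (e₀ ∘ σ) ∧ ∀ t, (e₀ ∘ σ) t ∈ C :=
      ⟨he₀.1.comp σ.injective, fun t ↦ he₀.2 _⟩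
    rw [dif_pos he]
    refine Equiv.ext fun t ↦ ?_
    rw [Equiv.trans_apply, Equiv.symm_apply_eq]
    rfl
  · intro e he
    rw [mem_linOrders] at he
    rw [dif_pos he]
    funext t
    simp only [Function.comp_apply, Equiv.trans_apply]
    have := equivOfLinOrder_apply hC e₀ he₀
      ((equivOfLinOrder hC e₀ he₀).symm (equivOfLinOrder hC e he t))
    rw [Equiv.apply_symm_apply] at this
    rw [← this]
    rfl

omit [Fintype α] [DecidableEq α] in
/-- A fixed ordering of `C`. [folklore] -/
theorem exists_linOrder : ∃ e₀ : Fin (n + 1) → α, Function.Injective e₀ ∧ ∀ t, e₀ t ∈ C := by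
  refine ⟨fun t ↦ ((C.equivFin.symm (Fin.cast hC.symm t) : C) : α), fun s t h ↦ ?_, fun t ↦ ?_⟩
  · have := C.equivFin.symm.injective (Subtype.val_injective h)
    exact Fin.cast_injective _ this
  · exact (C.equivFin.symm _).2

/-- **`S*(C) × C ↔ S_{|C|}`**: summing a function of orderings. [cite: RudnickSarnak1996, (4.36)] -/
theorem sum_cyc_sum_eq_sum_perm {R : Type*} [AddCommMonoid R] (X : (Fin (n + 1) → α) → R)
    (e₀ : Fin (n + 1) → α) (he₀ : Function.Injective e₀ ∧ ∀ t, e₀ t ∈ C) :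
    ∑ τ ∈ fib {C}, ∑ b ∈ C, X (orbitSeq τ b (n + 1)) = ∑ σ : Perm (Fin (n + 1)), X (e₀ ∘ σ) := by
  rw [sum_cyc_sum_eq_sum_linOrders hC, sum_linOrders_eq_sum_perm hC X e₀ he₀]

/-- **`#S*(C) = (|C| - 1)!`** ("cyclic permutations of `{1, …, n}`, of which there are
`(n - 1)!`", RS p. 312). [cite: RudnickSarnak1996, (4.33)] -/
theorem card_cyc : #(fib {C}) = n.factorial := by
  obtain ⟨e₀, he₀⟩ := exists_linOrder hC
  have h := sum_cyc_sum_eq_sum_perm hC (fun _ ↦ (1 : ℕ)) e₀ he₀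
  simp only [Finset.sum_const, smul_eq_mul, mul_one, Finset.card_univ, Fintype.card_perm,
    Fintype.card_fin, hC] at h
  rw [Nat.factorial_succ] at h
  have : #(fib {C}) * (n + 1) = n.factorial * (n + 1) := by rw [h]; ring
  exact Nat.eq_of_mul_eq_mul_right (Nat.succ_pos n) this

/-- **The sign of a cyclic permutation of `C` is `(-1)^{|C|-1}`** (RS p. 311). (Stated in `ℤ`:
with all of Mathlib imported, `(-1 : ℤˣ) ^ n` elaborates through `Int.instUnitsPow` rather than
the monoid power.) [cite: RudnickSarnak1996, proof of Prop 4.2] -/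
theorem sign_of_mem_cyc {τ : Perm α} (hτ : τ ∈ fib {C}) :
    (Equiv.Perm.sign τ : ℤ) = (-1) ^ n := by
  obtain ⟨hτC, hfix⟩ := mem_cyc.1 hτ
  rcases Nat.eq_zero_or_pos n with rfl | hn
  · -- a single point: `τ = 1`
    obtain ⟨a, ha⟩ := Finset.card_eq_one.1 hC
    have : τ = 1 := by
      ext x
      by_cases hx : x ∈ C
      · rw [ha, Finset.mem_singleton] at hx
        subst hx
        have := IsCycleOn.apply_mem' hτC (by rw [ha]; exact Finset.mem_singleton_self _)
        rw [ha, Finset.mem_singleton] at this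
        simpa using this
      · simpa using hfix x hx
    simp [this]
  · have hnt : (C : Set α).Nontrivial := by
      rw [Finset.nontrivial_coe, ← Finset.one_lt_card_iff_nontrivial]
      omega
    obtain ⟨a, ha⟩ : C.Nonempty := Finset.card_pos.1 (by omega)
    have hsupp : τ.support = C := by
      ext x
      rw [Equiv.Perm.mem_support]
      constructor
      · intro h
        by_contra hx
        exact h (hfix x hx)
      · intro hx
        exact hτC.apply_ne hnt (by simpa using hx)
    have hcyc : τ.IsCycle := by
      refine ⟨a, hτC.apply_ne hnt (by simpa using ha), fun y hy ↦ ?_⟩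
      have hyC : y ∈ C := by
        by_contra h
        exact hy (hfix y h)
      exact hτC.2 (by simpa using ha) (by simpa using hyC)
    rw [hcyc.sign, hsupp, hC, Units.val_neg, Units.val_pow_eq_pow_val, Units.val_neg,
      Units.val_one]
    ring

/-- `∑_{τ ∈ S*(C)} sign τ = (-1)^{|C|-1} (|C|-1)!` for a block of size `|C| = n + 1`.
[cite: RudnickSarnak1996, (4.4)] -/
theorem sum_cyc_sign {R : Type*} [CommRing R] :
    ∑ τ ∈ fib {C}, ((Equiv.Perm.sign τ : ℤ) : R) = (-1) ^ n * n.factorial := by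
  have h : ∀ τ ∈ fib {C}, ((Equiv.Perm.sign τ : ℤ) : R) = (-1) ^ n := by
    intro τ hτ
    rw [sign_of_mem_cyc hC hτ, Int.cast_pow, Int.cast_neg, Int.cast_one]
  rw [Finset.sum_congr rfl h, Finset.sum_const, card_cyc hC, nsmul_eq_mul, mul_comm]

end block

/-! ## The orbit partition -/

/-- Decidability of the orbit relation, for `Finpartition.ofSetoid`. [folklore] -/
instance instDecidableRelSetoidSameCycle (σ : Perm α) : DecidableRel (SameCycle.setoid σ).r :=
  fun x y ↦ inferInstanceAs (Decidable (σ.SameCycle x y))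

/-- The orbit partition of `σ`: the set partition of `α` into the `SameCycle` classes (the
blocks `F_j` of RS's decomposition `S_n = ⨆_F ∏_j S*(F_j)`).
[cite: RudnickSarnak1996, proof of Prop 4.2] -/
def cyclePart (σ : Perm α) : Finpartition (univ : Finset α) :=
  Finpartition.ofSetoid (SameCycle.setoid σ)

/-- [folklore] -/
theorem mem_part_cyclePart {σ : Perm α} {a b : α} : b ∈ (cyclePart σ).part a ↔ σ.SameCycle a b :=
  Finpartition.mem_part_ofSetoid_iff_rel

/-- Two set partitions of a finite type with the same block relation are equal. [folklore] -/
theorem _root_.Finpartition.eq_of_forall_mem_part_iff {P Q : Finpartition (univ : Finset α)}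
    (h : ∀ a b, b ∈ P.part a ↔ b ∈ Q.part a) : P = Q := by
  have key : ∀ {P Q : Finpartition (univ : Finset α)}, (∀ a b, b ∈ P.part a ↔ b ∈ Q.part a) →
      ∀ t ∈ P.parts, t ∈ Q.parts := by
    intro P Q h t ht
    obtain ⟨a, ha⟩ := P.nonempty_of_mem_parts ht
    have hPa : P.part a = t := P.part_eq_of_mem ht ha
    have hPQ : P.part a = Q.part a := Finset.ext (h a)
    rw [← hPa, hPQ]
    exact Q.part_mem.2 (Finset.mem_univ a)
  ext t
  exact ⟨key h t, key (fun a b ↦ (h a b).symm) t⟩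

/-- `σ ∈ fib G.parts` iff the orbit partition of `σ` is `G`. [folklore] -/
theorem mem_fib_parts_iff {σ : Perm α} {G : Finpartition (univ : Finset α)} :
    σ ∈ fib G.parts ↔ cyclePart σ = G := by
  constructor
  · intro h
    rw [mem_fib] at h
    refine Finpartition.eq_of_forall_mem_part_iff fun a b ↦ ?_
    rw [mem_part_cyclePart]
    have hGa : G.part a ∈ G.parts := G.part_mem.2 (Finset.mem_univ a)
    have hcyc := h.1 _ hGa
    have ha : a ∈ G.part a := G.mem_part_self.2 (Finset.mem_univ a)
    constructor
    · rintro ⟨i, rfl⟩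
      have := (hcyc.1.perm_zpow i).mapsTo (Finset.mem_coe.2 ha)
      simpa using this
    · intro hb
      exact hcyc.2 (Finset.mem_coe.2 ha) (Finset.mem_coe.2 hb)
  · rintro rfl
    rw [mem_fib]
    refine ⟨fun C hC ↦ ?_, fun x hx ↦ ?_⟩
    · obtain ⟨a, ha⟩ := (cyclePart σ).nonempty_of_mem_parts hC
      have hCa : (cyclePart σ).part a = C := (cyclePart σ).part_eq_of_mem hC ha
      subst hCa
      refine ⟨⟨fun x hx ↦ ?_, fun x _ y _ h ↦ σ.injective h, fun y hy ↦ ?_⟩, fun x hx y hy ↦ ?_⟩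
      · have hx' := mem_part_cyclePart.1 (by simpa using hx)
        simpa [mem_part_cyclePart] using hx'.apply_right
      · have hy' := mem_part_cyclePart.1 (by simpa using hy)
        refine ⟨σ⁻¹ y, ?_, by simp⟩
        have : σ.SameCycle a (σ⁻¹ y) := by
          rw [← sameCycle_apply_right]; simpa using hy'
        simpa [mem_part_cyclePart] using this
      · have hx' := mem_part_cyclePart.1 (by simpa using hx)
        have hy' := mem_part_cyclePart.1 (by simpa using hy)
        exact hx'.symm.trans hy'
    · exact absurd ((cyclePart σ).part_mem.2 (Finset.mem_univ x))
        (fun h ↦ hx _ h ((cyclePart σ).mem_part_self.2 (Finset.mem_univ x)))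

/-- **Grouping permutations by orbit partition**: `∑_{σ ∈ S_n} F(σ) = ∑_G ∑_{σ ∈ fib G} F(σ)`
(RS p. 311: `S_n = ⨆_F ∏_j S*(F_j)`). [cite: RudnickSarnak1996, proof of Prop 4.2] -/
theorem sum_perm_eq_sum_cyclePart {R : Type*} [AddCommMonoid R] (F : Perm α → R) :
    ∑ σ, F σ = ∑ G : Finpartition (univ : Finset α), ∑ σ ∈ fib G.parts, F σ := by
  classical
  rw [← Finset.sum_fiberwise univ cyclePart F]
  refine Finset.sum_congr rfl fun G _ ↦ Finset.sum_congr ?_ fun _ _ ↦ rfl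
  ext σ
  simp [mem_fib_parts_iff]

/-! ## The Möbius function of the partition lattice (RS (4.4)) -/

/-- `μ_t = (-1)^{|t|-1} (|t|-1)!`, the Möbius weight of a block. [cite: RudnickSarnak1996, (4.4)] -/
def blockMoebius (t : Finset α) : ℤ := (-1) ^ (#t - 1) * ((#t - 1).factorial : ℤ)

/-- For a set partition `P`: `∑_{σ ∈ fib P} sign σ = ∏_{t ∈ P} (-1)^{|t|-1} (|t|-1)!`.
[cite: RudnickSarnak1996, (4.4)] -/
theorem sum_sign_fib_parts (P : Finpartition (univ : Finset α)) :
    ∑ σ ∈ fib P.parts, (Equiv.Perm.sign σ : ℤ) = ∏ t ∈ P.parts, blockMoebius t := by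
  have h := sum_fib_eq_prod (R := ℤ) P.parts P.supIndep.pairwiseDisjoint (fun _ _ ↦ (1 : ℤ))
    (fun _ _ _ _ _ ↦ rfl)
  simp only [Finset.prod_const_one, mul_one, Int.cast_id] at h
  rw [h]
  refine Finset.prod_congr rfl fun t ht ↦ ?_
  have hpos : 0 < #t := Finset.card_pos.2 (P.nonempty_of_mem_parts ht)
  have hC : #t = (#t - 1) + 1 := by omega
  have := sum_cyc_sign (R := ℤ) hC
  simp only [Int.cast_id] at this
  rw [this, blockMoebius]

/-- The permutations preserving every block of `Q`. [folklore] -/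
def blockStab (Q : Finpartition (univ : Finset α)) : Finset (Perm α) :=
  univ.filter fun σ ↦ ∀ a, σ a ∈ Q.part a

/-- [folklore] -/
theorem mem_blockStab {Q : Finpartition (univ : Finset α)} {σ : Perm α} :
    σ ∈ blockStab Q ↔ ∀ a, σ a ∈ Q.part a := by
  simp [blockStab]

/-- The orbit partition of `σ` refines `Q` iff `σ` preserves the blocks of `Q`. [folklore] -/
theorem cyclePart_le_iff {σ : Perm α} {Q : Finpartition (univ : Finset α)} :
    cyclePart σ ≤ Q ↔ ∀ a, σ a ∈ Q.part a := by
  constructor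
  · intro h a
    obtain ⟨u, hu, hsub⟩ := h ((cyclePart σ).part_mem.2 (Finset.mem_univ a))
    have ha : a ∈ u := hsub ((cyclePart σ).mem_part_self.2 (Finset.mem_univ a))
    rw [Q.part_eq_of_mem hu ha]
    exact hsub (mem_part_cyclePart.2 (SameCycle.refl σ a).apply_right)
  · intro h t ht
    obtain ⟨a, ha⟩ := (cyclePart σ).nonempty_of_mem_parts ht
    have hta : (cyclePart σ).part a = t := (cyclePart σ).part_eq_of_mem ht ha
    refine ⟨Q.part a, Q.part_mem.2 (Finset.mem_univ a), fun b hb ↦ ?_⟩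
    rw [← hta, mem_part_cyclePart] at hb
    have hpow : ∀ m : ℕ, (σ ^ m) a ∈ Q.part a := by
      intro m
      induction m with
      | zero =>
        rw [pow_zero, Perm.one_apply]
        exact Q.mem_part_self.2 (Finset.mem_univ a)
      | succ m ih =>
        rw [pow_succ', Perm.mul_apply]
        have := h ((σ ^ m) a)
        rwa [Q.part_eq_of_mem (Q.part_mem.2 (Finset.mem_univ a)) ih] at this
    obtain ⟨m, rfl⟩ := hb.exists_nat_pow_eq
    exact hpow m

/-- The blocks of the discrete partition are singletons. [folklore] -/
theorem part_bot (a : α) : (⊥ : Finpartition (univ : Finset α)).part a = {a} :=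
  (⊥ : Finpartition (univ : Finset α)).part_eq_of_mem
    (Finpartition.mem_bot_iff.2 ⟨a, Finset.mem_univ a, rfl⟩) (Finset.mem_singleton_self a)

/-- A set partition other than `O` has a block with two distinct points. [folklore] -/
theorem exists_ne_of_ne_bot {Q : Finpartition (univ : Finset α)} (hQ : Q ≠ ⊥) :
    ∃ a b : α, a ≠ b ∧ b ∈ Q.part a := by
  by_contra h
  push Not at h
  refine hQ (Finpartition.eq_of_forall_mem_part_iff fun a b ↦ ?_)
  rw [part_bot, Finset.mem_singleton]
  constructor
  · intro hb
    by_contra hab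
    exact h a b (Ne.symm hab) hb
  · rintro rfl
    exact Q.mem_part_self.2 (Finset.mem_univ _)

/-- `∑_{σ ∈ Stab(Q)} sign σ = [Q = O]`: a transposition inside a non-trivial block is a
sign-reversing involution of `Stab(Q)`. [folklore] -/
theorem sum_sign_blockStab (Q : Finpartition (univ : Finset α)) :
    ∑ σ ∈ blockStab Q, (Equiv.Perm.sign σ : ℤ) = if Q = ⊥ then 1 else 0 := by
  split_ifs with hQ
  · subst hQ
    have : blockStab (⊥ : Finpartition (univ : Finset α)) = {1} := by
      ext σ
      rw [mem_blockStab, Finset.mem_singleton]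
      constructor
      · intro h
        ext a
        have := h a
        rw [part_bot, Finset.mem_singleton] at this
        simpa using this
      · rintro rfl a
        rw [part_bot]
        simp
    rw [this]
    simp
  · obtain ⟨a, b, hab, hb⟩ := exists_ne_of_ne_bot hQ
    have hpart : Q.part b = Q.part a :=
      Q.part_eq_of_mem (Q.part_mem.2 (Finset.mem_univ a)) hb
    have hswap : ∀ σ ∈ blockStab Q, σ * Equiv.swap a b ∈ blockStab Q := by
      intro σ hσ
      rw [mem_blockStab] at hσ ⊢
      intro x
      rw [Perm.mul_apply]
      have hx : Equiv.swap a b x ∈ Q.part x := by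
        rcases eq_or_ne x a with rfl | hxa
        · rw [Equiv.swap_apply_left]; exact hb
        rcases eq_or_ne x b with rfl | hxb
        · rw [Equiv.swap_apply_right, hpart]; exact Q.mem_part_self.2 (Finset.mem_univ _)
        · rw [Equiv.swap_apply_of_ne_of_ne hxa hxb]; exact Q.mem_part_self.2 (Finset.mem_univ _)
      have := hσ (Equiv.swap a b x)
      rwa [Q.part_eq_of_mem (Q.part_mem.2 (Finset.mem_univ x)) hx] at this
    refine Finset.sum_involution (fun σ _ ↦ σ * Equiv.swap a b) ?_ ?_ hswap ?_
    · intro σ _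
      rw [map_mul, Equiv.Perm.sign_swap hab, Units.val_mul]
      simp
    · intro σ _ _ h
      have : Equiv.swap a b = 1 := by
        have := congrArg (σ⁻¹ * ·) h
        simpa using this
      exact hab (Equiv.swap_eq_one_iff.1 this)
    · intro σ _
      rw [mul_assoc, Equiv.swap_mul_self, mul_one]

/-- **`∑_{P ≤ Q} ∏_{t ∈ P} μ_t = [Q = O]`** — the defining recursion of the Möbius function of
`Π_n` from `O`, for the product weights (4.4): the left side is `∑_{σ ∈ Stab(Q)} sign σ`.
[cite: RudnickSarnak1996, (4.4)] -/
theorem sum_le_prod_blockMoebius [DecidableRel (α := Finpartition (univ : Finset α)) (· ≤ ·)]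
    (Q : Finpartition (univ : Finset α)) :
    ∑ P ∈ (univ : Finset (Finpartition (univ : Finset α))).filter (· ≤ Q),
      ∏ t ∈ P.parts, blockMoebius t = if Q = ⊥ then 1 else 0 := by
  rw [← sum_sign_blockStab]
  simp_rw [← sum_sign_fib_parts]
  have hfib : ∀ P : Finpartition (univ : Finset α),
      fib P.parts = univ.filter (fun σ : Perm α ↦ cyclePart σ = P) := by
    intro P; ext σ; simp [mem_fib_parts_iff]
  simp_rw [hfib]
  rw [← Finset.sum_fiberwise_of_maps_to (s := blockStab Q) (t := univ.filter (· ≤ Q))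
    (g := cyclePart) (fun σ hσ ↦ by
      simp only [Finset.mem_filter, Finset.mem_univ, true_and]
      exact cyclePart_le_iff.2 (mem_blockStab.1 hσ)) (fun σ ↦ (Equiv.Perm.sign σ : ℤ))]
  refine Finset.sum_congr rfl fun P hP ↦ Finset.sum_congr ?_ fun _ _ ↦ rfl
  have hPQ : P ≤ Q := (Finset.mem_filter.1 hP).2
  ext σ
  simp only [Finset.mem_filter, Finset.mem_univ, true_and, mem_blockStab]
  constructor
  · intro h
    exact ⟨cyclePart_le_iff.1 (h ▸ hPQ), h⟩
  · exact fun h ↦ h.2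

end RudnickSarnak

/-! ## Discharge of the named fact `partitionMoebius_eq_prod` (RS (4.4)) -/

open RudnickSarnak in
/-- **RS (4.4), discharged**: the Möbius function of the lattice of set partitions of
`{0, …, n-1}` from the discrete partition is `μ(O, Q) = ∏_{t ∈ Q} (-1)^{|t|-1} (|t|-1)!`
(Rota 1964; Rudnick–Sarnak 1996, (4.4)). Proof: both sides satisfy `∑_{P ≤ Q} (·) = [Q = O]`
(`IncidenceAlgebra.sum_Icc_mu_right` and `sum_le_prod_blockMoebius`), which determines them by
induction on the interval `[O, Q]`. [cite: RudnickSarnak1996, (4.4)] -/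
theorem RudnickSarnak.partitionMoebius_eq_prod_holds : partitionMoebius_eq_prod := by
  intro n Q
  classical
  letI := finpartitionLocallyFiniteOrder n
  -- the closed form
  set f : Finpartition (univ : Finset (Fin n)) → ℤ := fun P ↦ ∏ t ∈ P.parts, blockMoebius t
    with hf
  suffices h : ∀ N (Q : Finpartition (univ : Finset (Fin n))), #(Finset.Icc ⊥ Q) = N →
      partitionMoebius Q = f Q by
    have := h _ Q rfl
    rw [this, hf]
    rfl
  intro N
  induction N using Nat.strong_induction_on with
  | _ N ih =>
    intro Q hN
    have hIcc : Finset.Icc ⊥ Q = univ.filter (· ≤ Q) := by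
      ext P; simp
    -- both recursions
    have h1 : ∑ P ∈ Finset.Icc ⊥ Q, partitionMoebius P = if Q = ⊥ then 1 else 0 := by
      unfold partitionMoebius
      rw [IncidenceAlgebra.sum_Icc_mu_right]
      simp only [eq_comm]
    have h2 : ∑ P ∈ Finset.Icc ⊥ Q, f P = if Q = ⊥ then 1 else 0 := by
      rw [hIcc, hf]
      exact sum_le_prod_blockMoebius Q
    have hdiff : ∑ P ∈ Finset.Icc ⊥ Q, (partitionMoebius P - f P) = 0 := by
      rw [Finset.sum_sub_distrib, h1, h2, sub_self]
    rw [← Finset.Ico_insert_right bot_le, Finset.sum_insert Finset.right_notMem_Ico] at hdiff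
    have hrest : ∑ P ∈ Finset.Ico ⊥ Q, (partitionMoebius P - f P) = 0 := by
      refine Finset.sum_eq_zero fun P hP ↦ ?_
      rw [Finset.mem_Ico] at hP
      rw [ih _ ?_ P rfl, sub_self]
      rw [← hN]
      apply Finset.card_lt_card
      refine ⟨Finset.Icc_subset_Icc_right hP.2.le, fun h ↦ ?_⟩
      have hQ : Q ∈ Finset.Icc ⊥ P := h (Finset.mem_Icc.2 ⟨bot_le, le_rfl⟩)
      exact (Finset.mem_Icc.1 hQ).2.not_gt hP.2
    rw [hrest, add_zero] at hdiff
    linarith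

end Literature.NumberTheory.LFunctions

end
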